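import Summits.Ventures.DiscreteObjects.Hadamard.Order333Normalizer668

/-!
# H(668): normaliser of the order-333 element ⇔ multiplier-invariant Legendre pairs — the core-exchanging case and the
# converse realisation (kernel); RHdQ's multiplier classes ARE the normaliser quotients

Framing: lottery ticket; floor = certified bounds/negative ranges.

Cell pub-namedobj (venture DiscreteObjects), target (H), hadamard gen 20; continuation of `Order333Normalizer668`.  Setting: a Hadamard
matrix `H` of order `668`, a signed automorphism `σ = (π, κ, d, e)` of pair order `333`, a signed automorphism `τ = (π', κ', d', e')`
with `π'π = π^μ π'`, `κ'κ = κ^μ κ'`.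
* **`hadamard668_order333_normalizer_sq_multiplier`** (core-EXCHANGING case): if `τ` moves a free row out of its `σ`-orbit, then
  `τ²` (multiplier `μ²`) preserves the cores [three points `x₀, τ x₀, τ² x₀` pairwise in different `σ`-orbits cannot fit into two
  orbits], so a Legendre pair of length `333` invariant under the multiplier `μ²` exists.  Hence for EVERY normalising `τ`:
  **`hadamard668_order333_normalizer_sq`** — an LP(333) invariant under `μ²` exists (so `μ²` avoids every excluded multiplier;
  in particular `μ` avoids the sixteen residues whose square reaches `112`/`223`, `hadamard668_order333_normalizer_sq_not_112_family`).
* **`twoCircCore_multiplier_aut`**, **`hadamard668_aut333_normalizer_of_invariant_legendrePair`** (converse, by construction): if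
  `(a, b)` is a Legendre pair of length `333` with both sequences invariant under a unit `u` (`x (u i) = x i`), the two-circulant-core
  matrix of its row-sum normalisation [FGS 2001] carries, besides the core shift `σ` of order `333` (gen 19), the MULTIPLIER
  PERMUTATION `τ_u : i ↦ u i` on both cores (border fixed), a permutation automorphism with `τ_u σ = σ^u τ_u` fixing the free row `0`.
* **`hadamard668_aut333_normalizer_iff_invariant_legendrePair333`** (the dictionary as an `iff`, for every `μ` prime to `333`):
  *some H(668) has an element `σ` of pair order `333` and a signed automorphism normalising it with multiplier `μ` that keeps a free
  row in its core* **iff** *a Legendre pair of length `333` invariant under the multiplier `μ` exists* — i.e. the 30 classes of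
  [Ramos–Hulak–de Queiroz 2026, Table A1] (subgroups `K ≤ U₁ ≤ (ℤ/333)ˣ`) are exactly the candidate quotients
  `(N_{Aut}(⟨σ⟩) ∩ core-preserving)/±⟨σ⟩` of an LP-type H(668), and each excluded row there (and in the cells' kernel files) is a
  statement 'no H(668) has automorphism group containing `C₃₃₃ ⋊ K` acting this way'.
Structure / dictionary of a hypothetical object; no order excluded; H(668) untouched.  Ours (the plug-in is FGS 2001, replication
side); no `sorry`, no definitions (the permutations are written as `Equiv.sumCongr` terms).
-/

namespace Summit.Ventures.DiscreteObjects.Hadamard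

open Finset BigOperators Matrix

open Literature.Combinatorics.Designs.GoethalsSeidel (IsHadamardMatrix)
open Literature.Combinatorics.Designs.LegendrePairs (PAF IsPM LegendrePair HInvariant CoreIdx twoCircCore twoCircCore_pm
  twoCircCore_mul_transpose rowsum_sq pm_of_sq card_coreIdx no_legendrePair_mul)

variable {ι : Type*} [Fintype ι] [DecidableEq ι]

/-! ### the core-exchanging case: `τ²` preserves the cores -/

section swap
variable {H : Matrix ι ι ℤ}

/-- **Core-exchanging normalising automorphisms square to core-preserving ones**: if `τ` (multiplier `μ`) moves the free row `x₀`
out of its `σ`-orbit, then `τ²` (a signed automorphism with multiplier `μ·μ`) maps `x₀` into its `σ`-orbit. -/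
theorem hadamard668_order333_normalizer_sq_mem (hH : IsHadamardMatrix H) (hι : Fintype.card ι = 668)
    {π κ π' κ' : Equiv.Perm ι} {d e d' e' : ι → ℤ} (haut : IsSignedAut H π κ d e)
    (hπ : π ^ 333 = 1) (hκ : κ ^ 333 = 1) (h111 : π ^ 111 ≠ 1 ∨ κ ^ 111 ≠ 1) (h9 : π ^ 9 ≠ 1 ∨ κ ^ 9 ≠ 1)
    (haut' : IsSignedAut H π' κ' d' e') {μ : ℕ} (hnπ : π' * π = π ^ μ * π') (hnκ : κ' * κ = κ ^ μ * κ')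
    {x₀ : ι} (hx₀ : π x₀ ≠ x₀) (hout : π' x₀ ∉ orbFin π 333 x₀) :
    (π' * π') * π = π ^ (μ * μ) * (π' * π') ∧ (κ' * κ') * κ = κ ^ (μ * μ) * (κ' * κ') ∧
      (π' * π') x₀ ∈ orbFin π 333 x₀ := by
  have hn2π : (π' * π') * π = π ^ (μ * μ) * (π' * π') := by
    rw [mul_assoc, hnπ, ← mul_assoc, norm_comm_pow hnπ μ, mul_assoc]
  have hn2κ : (κ' * κ') * κ = κ ^ (μ * μ) * (κ' * κ') := by
    rw [mul_assoc, hnκ, ← mul_assoc, norm_comm_pow hnκ μ, mul_assoc]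
  refine ⟨hn2π, hn2κ, ?_⟩
  have haut2 := isSignedAut_mul haut' haut'
  -- τ moves every free row out of its orbit; if τ² did too, three points would lie in three different orbits out of two
  rcases hadamard668_order333_normalizing_all_or_none hH hι haut hπ hκ h111 h9 haut' hnπ hnκ with ⟨hin, -⟩ | ⟨hout1, -⟩
  · exact absurd (hin x₀ hx₀) hout
  rcases hadamard668_order333_normalizing_all_or_none hH hι haut hπ hκ h111 h9 haut2 hn2π hn2κ with ⟨hin2, -⟩ | ⟨hout2, -⟩
  · exact hin2 x₀ hx₀
  exfalso
  obtain ⟨⟨-, hRfree⟩, -, -⟩ := hadamard668_order333_orbitType hH hι π κ d e haut hπ hκ h111 h9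
  -- row transversal of size 2
  have hstab : ∀ x ∈ univ.filter (fun x => π x ≠ x), π x ∈ univ.filter (fun x => π x ≠ x) := by
    intro x hx; rw [Finset.mem_filter] at hx ⊢; exact ⟨Finset.mem_univ _, fun h => hx.2 (π.injective h)⟩
  obtain ⟨T, hTsub, hTc, hT⟩ := exists_free_transversal π (by norm_num : 0 < 333) _ (univ.filter fun x => π x ≠ x) le_rfl
    hstab (fun x _ => by rw [hπ, Equiv.Perm.one_apply]) (fun x hx => hRfree x (Finset.mem_filter.mp hx).2)
  obtain ⟨⟨hR2, -⟩, -, -⟩ := hadamard668_order333_orbitType hH hι π κ d e haut hπ hκ h111 h9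
  have hsplit := Finset.card_filter_add_card_filter_not (s := (univ : Finset ι)) (fun x => π x = x)
  rw [hR2, Finset.card_univ, hι] at hsplit
  have hm666 : (univ.filter fun x => ¬ π x = x).card = 666 := by omega
  have hm666' : (univ.filter fun x => π x ≠ x).card = 666 := hm666
  rw [hm666'] at hTc
  have hT2 : T.card = 2 := by omega
  -- the three points and their representatives
  have hmv : ∀ x, π x ≠ x → π (π' x) ≠ π' x := fun x hx => by
    simpa only [pow_one] using norm_pow_moved hnπ 1 (by simpa only [pow_one] using hx)
  have hx₁ : π (π' x₀) ≠ π' x₀ := hmv x₀ hx₀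
  have hx₂ : π (π' (π' x₀)) ≠ π' (π' x₀) := hmv _ hx₁
  obtain ⟨r₀, hr₀T, k₀, hk₀, hrk₀⟩ := exists_rep_of_moved T hT hx₀
  obtain ⟨r₁, hr₁T, k₁, hk₁, hrk₁⟩ := exists_rep_of_moved T hT hx₁
  obtain ⟨r₂, hr₂T, k₂, hk₂, hrk₂⟩ := exists_rep_of_moved T hT hx₂
  -- two points with the same representative lie in one orbit
  have same : ∀ {r x y : ι} {k l : ℕ}, k < 333 → (π ^ k) r = x → (π ^ l) r = y → y ∈ orbFin π 333 x := by
    intro r x y k l hk hx hy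
    have hx333 : (π ^ 333) x = x := by rw [hπ, Equiv.Perm.one_apply]
    have e : y = (π ^ (l + (333 - k))) x := by
      rw [← hx, ← Equiv.Perm.mul_apply, ← pow_add, show l + (333 - k) + k = l + 333 by omega, pow_add, hπ, mul_one, hy]
    rw [e]; exact pow_apply_mem_orbFin_of_fixed π (by norm_num) hx333 _
  have h01 : r₀ ≠ r₁ := fun h => hout1 x₀ hx₀ (same hk₀ hrk₀ (h ▸ hrk₁))
  have h12 : r₁ ≠ r₂ := fun h => hout1 (π' x₀) hx₁ (same hk₁ hrk₁ (h ▸ hrk₂))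
  have h02 : r₀ ≠ r₂ := fun h => hout2 x₀ hx₀ (by
    have := same hk₀ hrk₀ (h ▸ hrk₂); rwa [Equiv.Perm.mul_apply])
  -- pigeonhole in the 2-set T
  have hsub : ({r₀, r₁, r₂} : Finset ι) ⊆ T := by
    intro z hz
    simp only [Finset.mem_insert, Finset.mem_singleton] at hz
    rcases hz with rfl | rfl | rfl <;> assumption
  have hcard3 : ({r₀, r₁, r₂} : Finset ι).card = 3 := by
    rw [Finset.card_insert_of_notMem, Finset.card_insert_of_notMem, Finset.card_singleton]
    · simpa using h12
    · simp only [Finset.mem_insert, Finset.mem_singleton, not_or]; exact ⟨h01, h02⟩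
  have := Finset.card_le_card hsub
  rw [hcard3, hT2] at this
  omega

/-- **Core-exchanging case ⇒ an LP(333) invariant under `μ²`.**  If `τ` moves a free row out of its `σ`-orbit, there are a unit
`u ≡ μ (mod 333)` and a Legendre pair of length `333` both of whose sequences are invariant under the multiplier `u²`. -/
theorem hadamard668_order333_normalizer_sq_multiplier (hH : IsHadamardMatrix H) (hι : Fintype.card ι = 668)
    {π κ π' κ' : Equiv.Perm ι} {d e d' e' : ι → ℤ} (haut : IsSignedAut H π κ d e)
    (hπ : π ^ 333 = 1) (hκ : κ ^ 333 = 1) (h111 : π ^ 111 ≠ 1 ∨ κ ^ 111 ≠ 1) (h9 : π ^ 9 ≠ 1 ∨ κ ^ 9 ≠ 1)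
    (haut' : IsSignedAut H π' κ' d' e') {μ : ℕ} (hnπ : π' * π = π ^ μ * π') (hnκ : κ' * κ = κ ^ μ * κ')
    {x₀ : ι} (hx₀ : π x₀ ≠ x₀) (hout : π' x₀ ∉ orbFin π 333 x₀) :
    ∃ (u : (ZMod 333)ˣ) (a b : ZMod 333 → ℤ), (u : ZMod 333) = (μ : ZMod 333) ∧ LegendrePair a b ∧
      HInvariant a (u ^ 2) ∧ HInvariant b (u ^ 2) := by
  obtain ⟨hn2π, hn2κ, hmem⟩ := hadamard668_order333_normalizer_sq_mem hH hι haut hπ hκ h111 h9 haut' hnπ hnκ hx₀ hout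
  obtain ⟨u', a, b, hu', hL, ha, hb⟩ := hadamard668_order333_normalizer_multiplier hH hι haut hπ hκ h111 h9
    (isSignedAut_mul haut' haut') hn2π hn2κ hx₀ hmem
  have hcop := coprime_of_normalizing hπ hκ h111 h9 hnπ hnκ
  refine ⟨ZMod.unitOfCoprime μ hcop, a, b, ZMod.coe_unitOfCoprime μ hcop, hL, ?_, ?_⟩
  · have e : ZMod.unitOfCoprime μ hcop ^ 2 = u' :=
      Units.ext (by rw [Units.val_pow_eq_pow_val, ZMod.coe_unitOfCoprime, hu']; push_cast; ring)
    rw [e]; exact ha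
  · have e : ZMod.unitOfCoprime μ hcop ^ 2 = u' :=
      Units.ext (by rw [Units.val_pow_eq_pow_val, ZMod.coe_unitOfCoprime, hu']; push_cast; ring)
    rw [e]; exact hb

/-- **Every normalising automorphism yields an LP(333) invariant under `μ²`** (core-preserving: invariant under `μ`, a fortiori
under `μ²`; core-exchanging: the previous theorem). -/
theorem hadamard668_order333_normalizer_sq (hH : IsHadamardMatrix H) (hι : Fintype.card ι = 668)
    {π κ π' κ' : Equiv.Perm ι} {d e d' e' : ι → ℤ} (haut : IsSignedAut H π κ d e)
    (hπ : π ^ 333 = 1) (hκ : κ ^ 333 = 1) (h111 : π ^ 111 ≠ 1 ∨ κ ^ 111 ≠ 1) (h9 : π ^ 9 ≠ 1 ∨ κ ^ 9 ≠ 1)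
    (haut' : IsSignedAut H π' κ' d' e') {μ : ℕ} (hnπ : π' * π = π ^ μ * π') (hnκ : κ' * κ = κ ^ μ * κ') :
    ∃ (u : (ZMod 333)ˣ) (a b : ZMod 333 → ℤ), (u : ZMod 333) = (μ : ZMod 333) ∧ LegendrePair a b ∧
      HInvariant a (u ^ 2) ∧ HInvariant b (u ^ 2) := by
  obtain ⟨⟨hR2, -⟩, -, -⟩ := hadamard668_order333_orbitType hH hι π κ d e haut hπ hκ h111 h9
  obtain ⟨x₀, hx₀⟩ : ∃ x, π x ≠ x := by
    by_contra hno
    push Not at hno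
    have : (univ.filter fun i => π i = i) = univ := Finset.filter_true_of_mem fun i _ => hno i
    rw [this, Finset.card_univ, hι] at hR2
    norm_num at hR2
  by_cases hmem : π' x₀ ∈ orbFin π 333 x₀
  · obtain ⟨u, a, b, hu, hL, ha, hb⟩ := hadamard668_order333_normalizer_multiplier hH hι haut hπ hκ h111 h9 haut' hnπ hnκ
      hx₀ hmem
    refine ⟨u, a, b, hu, hL, fun i => ?_, fun i => ?_⟩
    · rw [Units.val_pow_eq_pow_val, sq, mul_assoc, ha, ha]
    · rw [Units.val_pow_eq_pow_val, sq, mul_assoc, hb, hb]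
  · exact hadamard668_order333_normalizer_sq_multiplier hH hι haut hπ hκ h111 h9 haut' hnπ hnκ hx₀ hmem

/-- **Corollary (the extended `112`-family, ANY normalising automorphism).**  The multiplier of every normalising automorphism —
core-preserving or core-exchanging — satisfies
`μ mod 333 ∉ {31, 38, 43, 68, 110, 112, 142, 149, 184, 191, 221, 223, 265, 290, 295, 302}`: the sixteen units whose SQUARE has a
power equal to `112` or `223` (their 16th power is one of them; residues mod 9 in `{2,4,5,7}`, mod 37 in `{±1, ±6}`), excluded
because an LP(333) invariant under `μ²` would be invariant under `112` or `223` (`no_legendrePair_mul`). -/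
theorem hadamard668_order333_normalizer_sq_not_112_family (hH : IsHadamardMatrix H) (hι : Fintype.card ι = 668)
    {π κ π' κ' : Equiv.Perm ι} {d e d' e' : ι → ℤ} (haut : IsSignedAut H π κ d e)
    (hπ : π ^ 333 = 1) (hκ : κ ^ 333 = 1) (h111 : π ^ 111 ≠ 1 ∨ κ ^ 111 ≠ 1) (h9 : π ^ 9 ≠ 1 ∨ κ ^ 9 ≠ 1)
    (haut' : IsSignedAut H π' κ' d' e') {μ : ℕ} (hnπ : π' * π = π ^ μ * π') (hnκ : κ' * κ = κ ^ μ * κ') :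
    (μ : ZMod 333) ∉ ({31, 38, 43, 68, 110, 112, 142, 149, 184, 191, 221, 223, 265, 290, 295, 302} : Finset (ZMod 333)) := by
  intro hμ
  obtain ⟨u, a, b, hu, hL, ha, -⟩ := hadamard668_order333_normalizer_sq hH hι haut hπ hκ h111 h9 haut' hnπ hnκ
  have hpow : ∀ k : ℕ, ∀ i, a (((u ^ 2 : (ZMod 333)ˣ) : ZMod 333) ^ k * i) = a i := by
    intro k; induction k with
    | zero => intro i; simp
    | succ k ih => intro i; rw [pow_succ, mul_assoc, ih, ha]
  have h16 : ∀ i, a ((μ : ZMod 333) ^ 16 * i) = a i := by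
    intro i
    have := hpow 8 i
    rwa [Units.val_pow_eq_pow_val, hu, ← pow_mul] at this
  have key : (μ : ZMod 333) ^ 16 = ((111 : ℕ) : ZMod 333) + 1 ∨ (μ : ZMod 333) ^ 16 = 2 * ((111 : ℕ) : ZMod 333) + 1 := by
    simp only [Finset.mem_insert, Finset.mem_singleton] at hμ
    rcases hμ with h | h | h | h | h | h | h | h | h | h | h | h | h | h | h | h <;> rw [h] <;> decide
  exact no_legendrePair_mul (n := 333) (m := 111) (by norm_num) (by norm_num) a b hL.1 hL.2.1 hL.2.2 _ key (Or.inl h16)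

end swap

/-! ### the converse: the multiplier permutation of the two-circulant-core matrix of an invariant pair -/

section converse
variable {n : ℕ} [NeZero n]

/-- negating the first sequence preserves the Legendre-pair property -/
lemma legendrePair_neg_fst (a b : ZMod n → ℤ) (h : LegendrePair a b) : LegendrePair (-a) b := by
  obtain ⟨ha, hb, hL⟩ := h
  refine ⟨fun i => ?_, hb, fun s hs => ?_⟩
  · rcases ha i with h | h <;> simp [h]
  · rw [← hL s hs]; unfold PAF; simp

/-- negating the second sequence preserves the Legendre-pair property -/
lemma legendrePair_neg_snd (a b : ZMod n → ℤ) (h : LegendrePair a b) : LegendrePair a (-b) := by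
  obtain ⟨ha, hb, hL⟩ := h
  refine ⟨ha, fun i => ?_, fun s hs => ?_⟩
  · rcases hb i with h | h <;> simp [h]
  · rw [← hL s hs]; unfold PAF; simp

omit [NeZero n] in
/-- negation preserves multiplier invariance -/
lemma hInvariant_neg (x : ZMod n → ℤ) (u : (ZMod n)ˣ) (h : HInvariant x u) : HInvariant (-x) u :=
  fun i => by simp only [Pi.neg_apply, h i]

/-- row-sum normalisation of an invariant Legendre pair (both sums `+1`, invariance kept) -/
lemma legendrePair_normalise_invariant (a b : ZMod n → ℤ) (h : LegendrePair a b) (u : (ZMod n)ˣ)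
    (ha : HInvariant a u) (hb : HInvariant b u) :
    ∃ a' b' : ZMod n → ℤ, LegendrePair a' b' ∧ (∑ i, a' i) = 1 ∧ (∑ i, b' i) = 1 ∧ HInvariant a' u ∧ HInvariant b' u := by
  obtain ⟨a', ha1, hab', ha'⟩ : ∃ a' : ZMod n → ℤ, (∑ i, a' i) = 1 ∧ LegendrePair a' b ∧ HInvariant a' u := by
    rcases pm_of_sq _ _ (rowsum_sq a b h) with h1 | h1
    · exact ⟨a, h1, h, ha⟩
    · refine ⟨-a, ?_, legendrePair_neg_fst a b h, hInvariant_neg a u ha⟩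
      simp only [Pi.neg_apply, Finset.sum_neg_distrib, h1, neg_neg]
  obtain ⟨b', hb1, hab, hb'⟩ : ∃ b' : ZMod n → ℤ, (∑ i, b' i) = 1 ∧ LegendrePair a' b' ∧ HInvariant b' u := by
    have hsq := rowsum_sq a' b hab'
    rcases pm_of_sq _ _ (by rw [add_comm]; exact hsq) with h1 | h1
    · exact ⟨b, h1, hab', hb⟩
    · refine ⟨-b, ?_, legendrePair_neg_snd a' b hab', hInvariant_neg b u hb⟩
      simp only [Pi.neg_apply, Finset.sum_neg_distrib, h1, neg_neg]
  exact ⟨a', b', hab, ha1, hb1, ha', hb'⟩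

omit [NeZero n] in
/-- **the multiplier permutation** `τ_u = sumCongr (refl) (sumCongr (u·) (u·))` (both cores multiplied by the unit `u`, border fixed)
**is a permutation automorphism of the two-circulant-core matrix of a `u`-invariant pair** -/
theorem twoCircCore_multiplier_aut (a b : ZMod n → ℤ) (u : (ZMod n)ˣ) (ha : HInvariant a u) (hb : HInvariant b u)
    (x y : CoreIdx n) :
    twoCircCore a b ((Equiv.sumCongr (Equiv.refl (Unit ⊕ Unit)) (Equiv.sumCongr u.mulLeft u.mulLeft) : Equiv.Perm (CoreIdx n)) x)
      ((Equiv.sumCongr (Equiv.refl (Unit ⊕ Unit)) (Equiv.sumCongr u.mulLeft u.mulLeft) : Equiv.Perm (CoreIdx n)) y) =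
      twoCircCore a b x y := by
  have ha' : ∀ i j : ZMod n, a ((u : ZMod n) * i - (u : ZMod n) * j) = a (i - j) := fun i j => by rw [← mul_sub, ha]
  have hb' : ∀ i j : ZMod n, b ((u : ZMod n) * i - (u : ZMod n) * j) = b (i - j) := fun i j => by rw [← mul_sub, hb]
  rcases x with (v | v) | (i | i) <;> rcases y with (w | w) | (j | j) <;>
    simp [twoCircCore, Units.mulLeft_apply, ha', hb']

omit [NeZero n] in
/-- the multiplier permutation and the core shift: `τ_u σ = σ^m τ_u` whenever `u = m (mod n)` -/
lemma multiplier_coreShift_comm (u : (ZMod n)ˣ) (m : ℕ) (hm : (u : ZMod n) = (m : ZMod n)) :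
    (Equiv.sumCongr (Equiv.refl (Unit ⊕ Unit)) (Equiv.sumCongr u.mulLeft u.mulLeft) : Equiv.Perm (CoreIdx n)) *
      (Equiv.sumCongr (Equiv.refl (Unit ⊕ Unit))
        (Equiv.sumCongr (Equiv.addRight (1 : ZMod n)) (Equiv.addRight (1 : ZMod n))) : Equiv.Perm (CoreIdx n)) =
    (Equiv.sumCongr (Equiv.refl (Unit ⊕ Unit))
        (Equiv.sumCongr (Equiv.addRight (1 : ZMod n)) (Equiv.addRight (1 : ZMod n))) : Equiv.Perm (CoreIdx n)) ^ m *
      (Equiv.sumCongr (Equiv.refl (Unit ⊕ Unit)) (Equiv.sumCongr u.mulLeft u.mulLeft) : Equiv.Perm (CoreIdx n)) := by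
  obtain ⟨h1, h2, h3⟩ := coreShift_pow_apply (n := n) m
  ext x
  rw [Equiv.Perm.mul_apply, Equiv.Perm.mul_apply]
  rcases x with v | (i | i)
  · show (Sum.inl v : CoreIdx n) = ((Equiv.sumCongr (Equiv.refl (Unit ⊕ Unit))
        (Equiv.sumCongr (Equiv.addRight (1 : ZMod n)) (Equiv.addRight (1 : ZMod n))) : Equiv.Perm (CoreIdx n)) ^ m) (Sum.inl v)
    rw [h1]
  · show Sum.inr (Sum.inl ((u : ZMod n) * (i + 1))) = _
    rw [show ((Equiv.sumCongr (Equiv.refl (Unit ⊕ Unit)) (Equiv.sumCongr u.mulLeft u.mulLeft) : Equiv.Perm (CoreIdx n))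
      (Sum.inr (Sum.inl i)) : CoreIdx n) = Sum.inr (Sum.inl ((u : ZMod n) * i)) from rfl, h2, mul_add, mul_one, hm]
  · show Sum.inr (Sum.inr ((u : ZMod n) * (i + 1))) = _
    rw [show ((Equiv.sumCongr (Equiv.refl (Unit ⊕ Unit)) (Equiv.sumCongr u.mulLeft u.mulLeft) : Equiv.Perm (CoreIdx n))
      (Sum.inr (Sum.inr i)) : CoreIdx n) = Sum.inr (Sum.inr ((u : ZMod n) * i)) from rfl, h3, mul_add, mul_one, hm]

end converse

/-- **Invariant LP(333) ⇒ an H(668) with `σ` of order 333 AND a core-preserving normalising automorphism of multiplier `μ`.**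
For a Legendre pair of length `333` invariant under a unit `u ≡ μ (mod 333)`: the two-circulant-core matrix `H` (order `668`) of
its normalisation has the permutation automorphisms `σ` (core shift; `σ^333 = 1`, `σ^111 ≠ 1`, `σ^9 ≠ 1`) and `τ` (multiplier
permutation) with `τ σ = σ^μ τ`, and `τ` fixes the `σ`-free row `0` of the first core. -/
theorem hadamard668_aut333_normalizer_of_invariant_legendrePair (a b : ZMod 333 → ℤ) (h : LegendrePair a b)
    (u : (ZMod 333)ˣ) (ha : HInvariant a u) (hb : HInvariant b u) (μ : ℕ) (hu : (u : ZMod 333) = (μ : ZMod 333)) :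
    ∃ (H : Matrix (CoreIdx 333) (CoreIdx 333) ℤ) (σ τ : Equiv.Perm (CoreIdx 333)) (x₀ : CoreIdx 333),
      IsHadamardMatrix H ∧ Fintype.card (CoreIdx 333) = 668 ∧
      IsSignedAut H σ σ (fun _ => 1) (fun _ => 1) ∧ σ ^ 333 = 1 ∧ σ ^ 111 ≠ 1 ∧ σ ^ 9 ≠ 1 ∧
      IsSignedAut H τ τ (fun _ => 1) (fun _ => 1) ∧ τ * σ = σ ^ μ * τ ∧ σ x₀ ≠ x₀ ∧ τ x₀ ∈ orbFin σ 333 x₀ := by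
  obtain ⟨a', b', hab, ha1, hb1, ha', hb'⟩ := legendrePair_normalise_invariant a b h u ha hb
  have hcard : Fintype.card (CoreIdx 333) = 668 := by rw [card_coreIdx]
  obtain ⟨h1, h2, h3⟩ := coreShift_pow_apply (n := 333) 333
  refine ⟨twoCircCore a' b',
    (Equiv.sumCongr (Equiv.refl (Unit ⊕ Unit))
      (Equiv.sumCongr (Equiv.addRight (1 : ZMod 333)) (Equiv.addRight (1 : ZMod 333))) : Equiv.Perm (CoreIdx 333)),
    (Equiv.sumCongr (Equiv.refl (Unit ⊕ Unit)) (Equiv.sumCongr u.mulLeft u.mulLeft) : Equiv.Perm (CoreIdx 333)),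
    Sum.inr (Sum.inl 0), ⟨twoCircCore_pm a' b' hab.1 hab.2.1, ?_⟩, hcard, ?_, ?_, ?_, ?_, ?_,
    multiplier_coreShift_comm u μ hu, ?_, ?_⟩
  · rw [twoCircCore_mul_transpose a' b' hab ha1 hb1, hcard]; norm_num
  · exact ⟨fun _ => Or.inl rfl, fun _ => Or.inl rfl, fun x y => by rw [twoCircCore_coreShift]; ring⟩
  · ext x
    rcases x with v | (i | i)
    · rw [h1]; rfl
    · rw [h2, Equiv.Perm.one_apply, show ((333 : ℕ) : ZMod 333) = 0 from by decide, add_zero]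
    · rw [h3, Equiv.Perm.one_apply, show ((333 : ℕ) : ZMod 333) = 0 from by decide, add_zero]
  · intro h0
    have := congrArg (fun σ => σ (Sum.inr (Sum.inl 0))) h0
    simp only [(coreShift_pow_apply (n := 333) 111).2.1, Equiv.Perm.one_apply, zero_add] at this
    exact absurd (Sum.inl.inj (Sum.inr.inj this)) (by decide)
  · intro h0
    have := congrArg (fun σ => σ (Sum.inr (Sum.inl 0))) h0
    simp only [(coreShift_pow_apply (n := 333) 9).2.1, Equiv.Perm.one_apply, zero_add] at this
    exact absurd (Sum.inl.inj (Sum.inr.inj this)) (by decide)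
  · exact ⟨fun _ => Or.inl rfl, fun _ => Or.inl rfl, fun x y => by rw [twoCircCore_multiplier_aut a' b' u ha' hb']; ring⟩
  · intro h0
    have e : ((Equiv.sumCongr (Equiv.refl (Unit ⊕ Unit))
      (Equiv.sumCongr (Equiv.addRight (1 : ZMod 333)) (Equiv.addRight (1 : ZMod 333))) : Equiv.Perm (CoreIdx 333))
        (Sum.inr (Sum.inl 0)) : CoreIdx 333) = Sum.inr (Sum.inl (0 + 1)) := rfl
    rw [e] at h0
    exact absurd (Sum.inl.inj (Sum.inr.inj h0)) (by decide)
  · have e : ((Equiv.sumCongr (Equiv.refl (Unit ⊕ Unit)) (Equiv.sumCongr u.mulLeft u.mulLeft) : Equiv.Perm (CoreIdx 333))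
        (Sum.inr (Sum.inl 0)) : CoreIdx 333) = Sum.inr (Sum.inl ((u : ZMod 333) * 0)) := rfl
    rw [e, mul_zero]
    exact mem_orbFin_self _ (by norm_num) _

/-- **The dictionary as an `iff` (order 333, every multiplier `μ` prime to `333`).**  *Some Hadamard matrix of order `668` has a
signed automorphism `σ = (π, κ, d, e)` of pair order `333` together with a signed automorphism `τ` normalising its permutation
pair with multiplier `μ` (`π'π = π^μ π'`, `κ'κ = κ^μ κ'`) and keeping some free row inside its `σ`-orbit* **iff** *there is a Legendre
pair of length `333` both of whose sequences are invariant under the multiplier `μ`* (narrow sense, RHdQ 2026 Def. 2). -/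
theorem hadamard668_aut333_normalizer_iff_invariant_legendrePair333 (μ : ℕ) (hμ : Nat.Coprime μ 333) :
    (∃ (ι : Type) (_ : Fintype ι) (_ : DecidableEq ι) (H : Matrix ι ι ℤ) (π κ π' κ' : Equiv.Perm ι)
        (d e d' e' : ι → ℤ) (x₀ : ι),
        Fintype.card ι = 668 ∧ IsHadamardMatrix H ∧ IsSignedAut H π κ d e ∧ π ^ 333 = 1 ∧ κ ^ 333 = 1 ∧
        (π ^ 111 ≠ 1 ∨ κ ^ 111 ≠ 1) ∧ (π ^ 9 ≠ 1 ∨ κ ^ 9 ≠ 1) ∧ IsSignedAut H π' κ' d' e' ∧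
        π' * π = π ^ μ * π' ∧ κ' * κ = κ ^ μ * κ' ∧ π x₀ ≠ x₀ ∧ π' x₀ ∈ orbFin π 333 x₀) ↔
    ∃ a b : ZMod 333 → ℤ, LegendrePair a b ∧
      HInvariant a (ZMod.unitOfCoprime μ hμ) ∧ HInvariant b (ZMod.unitOfCoprime μ hμ) := by
  constructor
  · rintro ⟨ι, _, _, H, π, κ, π', κ', d, e, d', e', x₀, hι, hH, haut, hπ, hκ, h111, h9, haut', hnπ, hnκ, hx₀, hmem⟩
    obtain ⟨u, a, b, hu, hL, ha, hb⟩ := hadamard668_order333_normalizer_multiplier hH hι haut hπ hκ h111 h9 haut' hnπ hnκ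
      hx₀ hmem
    have e : ZMod.unitOfCoprime μ hμ = u := Units.ext (by rw [ZMod.coe_unitOfCoprime, hu])
    exact ⟨a, b, hL, by rw [e]; exact ha, by rw [e]; exact hb⟩
  · rintro ⟨a, b, hL, ha, hb⟩
    obtain ⟨H, σ, τ, x₀, hH, hcard, hσ, h333, h111, h9, hτ, hcomm, hx₀, hmem⟩ :=
      hadamard668_aut333_normalizer_of_invariant_legendrePair a b hL _ ha hb μ (ZMod.coe_unitOfCoprime μ hμ)
    exact ⟨CoreIdx 333, inferInstance, inferInstance, H, σ, σ, τ, τ, _, _, _, _, x₀, hcard, hH, hσ, h333, h333,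
      Or.inl h111, Or.inl h9, hτ, hcomm, hcomm, hx₀, hmem⟩

end Summit.Ventures.DiscreteObjects.Hadamard
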